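import Mathlib
import Summits.Ventures.PercRepro2.ThreeTermTransport
import Summits.Ventures.PercRepro2.ThreeTermInstanceHOB

/-!
# Three-terminal parts, V d: ROW 2′TRI ON THE CORE `HOB` PLUS EVERY THREE-TERMINAL PART
(blind cell PercRepro2, night-3 g30, 2026-08-29; `proofs/NIGHT3-CERT.md` §39.7)

The core `HOB` (five marks `l h o b a₃`, typed edges `h–o`, `h–b` of type `1`, terminal triple
`(l, o, b)`) has its partition table evaluated in the kernel and certified in the Harris cone
(ThreeTermInstanceHOB.lean: `partTable5_eq`, `inCone_HOB`).  Along the embedding of the model part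
graph into the part graph of ANY instance that consists of the core and an unmarked three-terminal part
`Γ` at `(l, o, b)` (ThreeTermTransport.lean), the instance's table IS the model's table
(`partTable5_eq_HOB`) — the part's other edges are pinned closed and looped, its vertices isolated —
so the certificate applies, and with `typedHarris_part` (nothing to check on `Γ`):

* **`typedCount_nonneg_HOB_part`**: for every finite graph made of the core `HOB` and a three-terminal
  part `Γ` at `(l, o, b)` — any number of vertices and edges in `Γ`, any type map on `Γ`'s edges, any
  pinning — the typed base `typedCount (F ∪ S) z τ K₃` is nonnegative: row 2′TRI on an INFINITE family
  (`HOB + K_{3,n}` leaf bundles for every `n`, `HOB +` every two-internal-vertex gadget, …) from one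
  finite certificate, beyond every census rung.

Own work; standard axioms.
-/

namespace Summit.Ventures.PercRepro2

open TypedStar Part ThreeTerm

namespace InstHOB

section Congr

variable {E : Type*} [Fintype E] [DecidableEq E] {R : Type*} [CommRing R]

/-- The per-copy pinned count reads the pins off `F` only. -/
lemma typedCount3_congr_pins (F : Finset E) {z₁ z₂ z₃ z₁' z₂' z₃' : Config E}
    (h1 : ∀ e, e ∉ F → z₁ e = z₁' e) (h2 : ∀ e, e ∉ F → z₂ e = z₂' e) (h3 : ∀ e, e ∉ F → z₃ e = z₃' e)
    (τ : E → ℕ) (K : Config E → Config E → Config E → R) :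
    typedCount3 F z₁ z₂ z₃ τ K = typedCount3 F z₁' z₂' z₃' τ K := by
  unfold typedCount3
  refine Finset.sum_congr rfl fun x _ => Finset.sum_congr rfl fun y _ => Finset.sum_congr rfl fun w _ => ?_
  have : (∀ e, e ∉ F → x e = z₁ e ∧ y e = z₂ e ∧ w e = z₃ e) ↔
      (∀ e, e ∉ F → x e = z₁' e ∧ y e = z₂' e ∧ w e = z₃' e) := by
    constructor
    · intro h e he
      rw [← h1 e he, ← h2 e he, ← h3 e he]; exact h e he
    · intro h e he
      rw [h1 e he, h2 e he, h3 e he]; exact h e he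
  rw [if_congr (and_congr_left' this) rfl rfl]

end Congr

section All

variable {V E : Type} [Fintype E] [DecidableEq E]

/-- The vertex map of the embedding: the five marks and one vertex of the part. -/
def ν (l h o b a₃ w₀ : V) : Fin 6 → V := ![l, h, o, b, a₃, w₀]

/-- The edge map of the embedding: the two core edges and the three distinguished part edges. -/
def ι (eho ehb e₁ e₂ e₃ : E) : Fin 5 → E := ![eho, ehb, e₁, e₂, e₃]

/-- **ROW 2′TRI ON THE CORE `HOB` PLUS ANY THREE-TERMINAL PART.** The instance: a graph `ends` on `V, E`
with the five marks `l h o b a₃` (distinct), the core edges `eho = {h, o}`, `ehb = {h, b}`, an unmarked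
three-terminal part `W` at `(l, o, b)` with edge set `S` (three distinguished edges `e₁ e₂ e₃ ∈ S`), and
no other edges (`hcover`); any pinning `z`, any type map `τ` with `τ eho = τ ehb = 1`. -/
theorem typedCount_nonneg_HOB_part (ends : E → Sym2 V) (l h o b a₃ : V) (eho ehb : E) (W : Set V)
    (S : Finset E) (e₁ e₂ e₃ : E)
    (hlh : l ≠ h) (hlo : l ≠ o) (hlb : l ≠ b) (hla : l ≠ a₃) (hho : h ≠ o) (hhb : h ≠ b) (hha : h ≠ a₃)
    (hob : o ≠ b) (hoa : o ≠ a₃) (hba : b ≠ a₃)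
    (hends_ho : ends eho = s(h, o)) (hends_hb : ends ehb = s(h, b)) (hne : eho ≠ ehb)
    (hW : IsPart ends W l o b) (hS : ∀ e, e ∈ S ↔ e ∈ touches ends W) (hh : h ∉ W) (ha : a₃ ∉ W)
    (h1 : e₁ ∈ S) (h2 : e₂ ∈ S) (h3 : e₃ ∈ S) (h12 : e₁ ≠ e₂) (h13 : e₁ ≠ e₃) (h23 : e₂ ≠ e₃)
    (hcover : ∀ e, e = eho ∨ e = ehb ∨ e ∈ S)
    (z : Config E) (τ : E → ℕ) (hτ0 : τ eho = 1) (hτ1 : τ ehb = 1) :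
    0 ≤ typedCount ({eho, ehb} ∪ S) z τ (CovForm.K3 (R := ℚ) ends o l h a₃ b) := by
  have hl : l ∉ W := hW.t₁_notMem
  have ho : o ∉ W := hW.t₂_notMem
  have hb : b ∉ W := hW.t₃_notMem
  -- the core edges are not part edges
  have hhoS : eho ∉ S := by
    rw [hS]
    rintro ⟨x, hx, y, hxy⟩
    rw [hends_ho, Sym2.eq_iff] at hxy
    rcases hxy with ⟨rfl, -⟩ | ⟨-, rfl⟩
    · exact hh hx
    · exact ho hx
  have hhbS : ehb ∉ S := by
    rw [hS]
    rintro ⟨x, hx, y, hxy⟩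
    rw [hends_hb, Sym2.eq_iff] at hxy
    rcases hxy with ⟨rfl, -⟩ | ⟨-, rfl⟩
    · exact hh hx
    · exact hb hx
  -- a vertex of the part
  obtain ⟨w₀, hw₀, -⟩ := (hS e₁).1 h1
  have hw₀l : w₀ ≠ l := fun h => hl (h ▸ hw₀)
  have hw₀h : w₀ ≠ h := fun h' => hh (h' ▸ hw₀)
  have hw₀o : w₀ ≠ o := fun h => ho (h ▸ hw₀)
  have hw₀b : w₀ ≠ b := fun h => hb (h ▸ hw₀)
  have hw₀a : w₀ ≠ a₃ := fun h => ha (h ▸ hw₀)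
  -- the embedding of the model part graph into the instance's part graph
  set ends' := partEnds ends (↑S) e₁ e₂ e₃ l o b with hends'
  have hne1 : eho ≠ e₁ := fun h => hhoS (h ▸ h1)
  have hne2 : eho ≠ e₂ := fun h => hhoS (h ▸ h2)
  have hne3 : eho ≠ e₃ := fun h => hhoS (h ▸ h3)
  have hnb1 : ehb ≠ e₁ := fun h => hhbS (h ▸ h1)
  have hnb2 : ehb ≠ e₂ := fun h => hhbS (h ▸ h2)
  have hnb3 : ehb ≠ e₃ := fun h => hhbS (h ▸ h3)
  let φ : PartEmbed pg ends' :=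
    { ν := ν l h o b a₃ w₀
      ι := ι eho ehb e₁ e₂ e₃
      ν_inj := by
        intro i j hij
        fin_cases i <;> fin_cases j <;> simp_all [ν]
      ι_inj := by
        intro i j hij
        fin_cases i <;> fin_cases j <;> simp_all [ι]
      ends_eq := by
        intro i
        fin_cases i
        · show partEnds ends (↑S) e₁ e₂ e₃ l o b eho = Sym2.map (ν l h o b a₃ w₀) s(1, 2)
          rw [partEnds_apply_of_notMem ends (↑S) l o b h1 h2 h3 hhoS, hends_ho]
          rfl
        · show partEnds ends (↑S) e₁ e₂ e₃ l o b ehb = Sym2.map (ν l h o b a₃ w₀) s(1, 3)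
          rw [partEnds_apply_of_notMem ends (↑S) l o b h1 h2 h3 hhbS, hends_hb]
          rfl
        · show partEnds ends (↑S) e₁ e₂ e₃ l o b e₁ = Sym2.map (ν l h o b a₃ w₀) s(0, 2)
          rw [partEnds_apply_1]
          rfl
        · show partEnds ends (↑S) e₁ e₂ e₃ l o b e₂ = Sym2.map (ν l h o b a₃ w₀) s(0, 3)
          rw [partEnds_apply_2 ends (↑S) l o b h12]
          rfl
        · show partEnds ends (↑S) e₁ e₂ e₃ l o b e₃ = Sym2.map (ν l h o b a₃ w₀) s(2, 3)
          rw [partEnds_apply_3 ends (↑S) l o b h13 h23]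
          rfl }
  -- the typed edges of the instance are the image of the model's
  have hF : ({eho, ehb} : Finset E) = Finset.map ⟨φ.ι, φ.ι_inj⟩ InstHOB.F := by
    ext e
    simp only [Finset.mem_insert, Finset.mem_singleton, Finset.mem_map, Function.Embedding.coeFn_mk]
    constructor
    · rintro (rfl | rfl)
      · exact ⟨0, by decide, rfl⟩
      · exact ⟨1, by decide, rfl⟩
    · rintro ⟨i, hi, rfl⟩
      have hi' : i = 0 ∨ i = 1 := by
        revert hi
        change i ∈ ({0, 1} : Finset (Fin 5)) → _
        simp
      rcases hi' with rfl | rfl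
      · exact Or.inl rfl
      · exact Or.inr rfl
  -- the pins of the instance's table are the extensions of the model's pins (off the typed edges)
  have hpin : ∀ (p : Fin 5) (e : E), e ∉ ({eho, ehb} : Finset E) →
      setOn S (cfg e₁ e₂ e₃ (rep5 p)) z e = ext φ (pin p) e := by
    intro p e he
    have heS : e ∈ S := by
      rcases hcover e with rfl | rfl | h
      · exact absurd (Finset.mem_insert_self _ _) he
      · exact absurd (Finset.mem_insert_of_mem (Finset.mem_singleton_self _)) he
      · exact h
    rw [setOn_of_mem heS]
    by_cases k1 : e = e₁
    · rw [k1]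
      have : ext φ (pin p) e₁ = pin p 2 := ext_ι φ (pin p) 2
      rw [this]
      simp [cfg, pin, setOn, InstHOB.S]
    by_cases k2 : e = e₂
    · rw [k2]
      have : ext φ (pin p) e₂ = pin p 3 := ext_ι φ (pin p) 3
      rw [this]
      simp [cfg, pin, setOn, InstHOB.S, h12.symm]
    by_cases k3 : e = e₃
    · rw [k3]
      have : ext φ (pin p) e₃ = pin p 4 := ext_ι φ (pin p) 4
      rw [this]
      simp [cfg, pin, setOn, InstHOB.S, h13.symm, h23.symm]
    · have hoff : ∀ i : Fin 5, φ.ι i ≠ e := by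
        intro i
        fin_cases i
        · exact fun h' => he (h' ▸ Finset.mem_insert_self _ _)
        · exact fun h' => he (h' ▸ Finset.mem_insert_of_mem (Finset.mem_singleton_self _))
        · exact fun h' => k1 h'.symm
        · exact fun h' => k2 h'.symm
        · exact fun h' => k3 h'.symm
      rw [ext_off φ (pin p) hoff]
      simp [cfg, k1, k2, k3]
  -- the instance's table is the model's table
  have hτF : ∀ e ∈ InstHOB.F, τ (φ.ι e) = τ₀ e := by
    intro e he
    have he' : e = 0 ∨ e = 1 := by
      revert he
      change e ∈ ({0, 1} : Finset (Fin 5)) → _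
      simp
    rcases he' with rfl | rfl
    · exact hτ0
    · exact hτ1
  have htab : ∀ p q r, partTable5 ends S e₁ e₂ e₃ l o b o l h a₃ b {eho, ehb} z τ p q r = (tbl5 p q r : ℚ) := by
    intro p q r
    rw [← partTable5_eq p q r]
    unfold partTable5 partTable
    rw [partEnds_eq]
    rw [typedCount3_congr_pins {eho, ehb} (hpin p) (hpin q) (hpin r) τ _]
    rw [hF, typedCount3_ext φ InstHOB.F (pin p) (pin q) (pin r) hτF]
    show typedCount3 InstHOB.F (pin p) (pin q) (pin r) τ₀ _ =
      typedCount3 InstHOB.F (pin p) (pin q) (pin r) τ₀ (CovForm.K3 (R := ℚ) pg 2 0 1 4 3)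
    congr 1
    funext x y w
    exact (K3_ext φ 2 0 1 4 3 x y w).symm
  -- the certificate transports
  have hcone : InCone (fun ν' => ∑ p : Fin 5, ∑ q : Fin 5, ∑ r : Fin 5,
      partTable5 ends S e₁ e₂ e₃ l o b o l h a₃ b {eho, ehb} z τ p q r * mono p q r ν') := by
    have e : (fun ν' => ∑ p : Fin 5, ∑ q : Fin 5, ∑ r : Fin 5,
        partTable5 ends S e₁ e₂ e₃ l o b o l h a₃ b {eho, ehb} z τ p q r * mono p q r ν') =
        (fun ν' => ∑ p : Fin 5, ∑ q : Fin 5, ∑ r : Fin 5,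
        partTable5 InstHOB.ends InstHOB.S 2 3 4 0 2 3 2 0 1 4 3 InstHOB.F z₀ τ₀ p q r * mono p q r ν') := by
      funext ν'
      simp only [htab, partTable5_eq]
    rw [e]
    exact inCone_HOB
  have hd : Disjoint ({eho, ehb} : Finset E) S := by
    rw [Finset.disjoint_left]
    intro e he
    simp only [Finset.mem_insert, Finset.mem_singleton] at he
    rcases he with rfl | rfl
    · exact hhoS
    · exact hhbS
  exact typedCount_part_nonneg_of_inCone5' (ends := ends) (W := W) (t₁ := l) (t₂ := o) (t₃ := b) hW
    (S := S) hS (e₁ := e₁) (e₂ := e₂) (e₃ := e₃) h1 h2 h3 h12 h13 h23 (o := o) (a₁ := l) (a₂ := h)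
    (a₃ := a₃) (b := b) ho hl hh ha hb (F := {eho, ehb}) hd z τ hcone

end All

end InstHOB

end Summit.Ventures.PercRepro2
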